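import Literature.Probability.Percolation.IntPairUp
import HarnessLib

/-!
# The cross-frame inner pair step: two arms of the same colour on different inner sides (Menger) (twin of `TrapPairCross.lean`)

Topic `Literature/Probability/Percolation`; family `crit-perc` / near-critical percolation on `𝕋`.
A brick of the INNER half of the near-critical arm-separation theorem for four arms in the ADJACENT
colour arrangement (P. Nolin, EJP 13 (2008), Thm. 11, `j = 4`, `σ = BBWW` [arXiv 0711.4948:
Thm. 10], §4.4 Lemma 15, internal extremities). Word-for-word twin of `TrapPairCross.lean`:
`IntCrossData` (two `IntPairDataB` structures, one per inner side, two graph automorphisms carrying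
their coordinates to actual sites), `Aset𝔄`, `Tset𝔗`, `Src`, the cut notions, `IntPairDataB_route_or`,
`not_isCut𝔄`, `menger_hcut𝔄`, `menger_hone𝔄`, `src_ne`, `exists_two_disjoint_routes`.

Everything here is proved; no named facts are introduced.

## References

* P. Nolin, Near-critical percolation in two dimensions, *Electron. J. Probab.* 13 (2008), §4.4,
  proof of Lemma 15, internal extremities (arXiv 0711.4948: Lemma 14) [Nolin2008].
* R. Diestel, *Graph Theory*, 5th ed. (2017), Thm. 3.3.1 (Menger) [Diestel2017].
-/

noncomputable section

open Set

namespace Literature.Probability.Percolation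

open LatticeModels HalfAnnulus Literature.Combinatorics.SimpleGraph

/-- **The cross-frame setting.** Two `PairDataB` structures (one per side), two graph
automorphisms carrying their coordinates to actual sites, the correspondence of the arms and
starts, and the disjointness of the actual fence sites of the two sides. [cite: Nolin2008, §4.4 Lemma 15 (proof) (arXiv 0711.4948: Lemma 14)] -/
structure IntCrossData (m N k₀ K T₁ T₁' T₂ T₂' R₀ : ℕ) (χ₁ χ₂ : SiteConfig (Site 2)) where
  D₁ : IntPairDataB m N k₀ K T₁ T₁' R₀ χ₁
  D₂ : IntPairDataB m N k₀ K T₂ T₂' R₀ χ₂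
  φ₁ : triGraph ≃g triGraph
  φ₂ : triGraph ≃g triGraph
  /-- the arm `0` of `D₁` and the arm `1` of `D₂` are the same actual arm -/
  arm0 : ∀ v, v ∈ (D₁.A 0).support ↔ φ₂.symm (φ₁ v) ∈ (D₂.A 1).support
  /-- the arm `1` of `D₁` and the arm `0` of `D₂` are the same actual arm -/
  arm1 : ∀ v, v ∈ (D₁.A 1).support ↔ φ₂.symm (φ₁ v) ∈ (D₂.A 0).support
  start0 : φ₁ (D₁.b 0) = φ₂ (D₂.b 1)
  start1 : φ₁ (D₁.b 1) = φ₂ (D₂.b 0)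
  /-- actual fence sites of the two sides differ -/
  fence_far : ∀ x y : Site 2,
    ((∃ (u : ℕ) (c : Finset (Site 2)) (z : Site 2) (hu : (intDom m).lowestSeq χ₁ u = some (c, z)), x ∈ (D₁.fence hu).F) ∨
      (∃ (u : ℕ) (d : Finset (Site 2)) (z : Site 2) (hu : (intDom m).flip.lowestSeq χ₁ u = some (d, z)), x ∈ (D₁.fenceUp hu).F)) →
    ((∃ (u : ℕ) (c : Finset (Site 2)) (z : Site 2) (hu : (intDom m).lowestSeq χ₂ u = some (c, z)), y ∈ (D₂.fence hu).F) ∨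
      (∃ (u : ℕ) (d : Finset (Site 2)) (z : Site 2) (hu : (intDom m).flip.lowestSeq χ₂ u = some (d, z)), y ∈ (D₂.fenceUp hu).F)) →
    φ₁ x ≠ φ₂ y

namespace IntCrossData

variable {m N k₀ K T₁ T₁' T₂ T₂' R₀ : ℕ} {χ₁ χ₂ : SiteConfig (Site 2)} (X : IntCrossData m N k₀ K T₁ T₁' T₂ T₂' R₀ χ₁ χ₂)

/-- The actual admissible sites. [folklore] -/
def Aset𝔄 : Set (Site 2) := X.φ₁ '' X.D₁.AsetB ∪ X.φ₂ '' X.D₂.AsetB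

/-- The actual targets. [folklore] -/
def Tset𝔗 : Set (Site 2) := X.φ₁ '' X.D₁.TsetB ∪ X.φ₂ '' X.D₂.TsetB

/-- The actual starts. [folklore] -/
def Src : Set (Site 2) := {X.φ₁ (X.D₁.b 0), X.φ₁ (X.D₁.b 1)}

/-- The actual arm sites are the images of the arm sites of either structure. [folklore] -/
theorem armSet_corr (X : IntCrossData m N k₀ K T₁ T₁' T₂ T₂' R₀ χ₁ χ₂) {v : Site 2} : v ∈ X.D₁.armSet ↔ X.φ₂.symm (X.φ₁ v) ∈ X.D₂.armSet := by
  constructor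
  · rintro ⟨i, hv⟩
    fin_cases i
    · exact ⟨1, (X.arm0 v).1 hv⟩
    · exact ⟨0, (X.arm1 v).1 hv⟩
  · rintro ⟨i, hv⟩
    fin_cases i
    · exact ⟨1, (X.arm1 v).2 hv⟩
    · exact ⟨0, (X.arm0 v).2 hv⟩

/-- A start of `D₂` is an actual start. [folklore] -/
theorem start_mem₂ (X : IntCrossData m N k₀ K T₁ T₁' T₂ T₂' R₀ χ₁ χ₂) (i : Fin 2) : X.φ₂ (X.D₂.b i) ∈ X.Src := by
  fin_cases i
  · exact Or.inr (by rw [Set.mem_singleton_iff]; exact X.start1.symm)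
  · exact Or.inl X.start0.symm

/-- A start of `D₁` is an actual start. [folklore] -/
theorem start_mem₁ (X : IntCrossData m N k₀ K T₁ T₁' T₂ T₂' R₀ χ₁ χ₂) (i : Fin 2) : X.φ₁ (X.D₁.b i) ∈ X.Src := by
  fin_cases i
  · exact Or.inl rfl
  · exact Or.inr rfl

/-! ### Transport of reachability -/

/-- A `D₁`-admissible path avoiding `z₁` is an actual admissible path avoiding `φ₁ z₁`. [folklore] -/
theorem pathIn_image₁ (X : IntCrossData m N k₀ K T₁ T₁' T₂ T₂' R₀ χ₁ χ₂) {z₁ x y : Site 2} (h : PathIn triGraph (X.D₁.AsetB \ {z₁}) x y) :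
    PathIn triGraph (X.Aset𝔄 \ {X.φ₁ z₁}) (X.φ₁ x) (X.φ₁ y) := by
  refine (pathIn_map_iso X.φ₁ h).mono ?_
  rintro w ⟨v, ⟨hv, hvz⟩, rfl⟩
  exact ⟨Or.inl ⟨v, hv, rfl⟩, fun e => hvz (X.φ₁.injective (Set.mem_singleton_iff.1 e))⟩

/-- A `D₂`-admissible path avoiding `z₂` is an actual admissible path avoiding `φ₂ z₂`. [folklore] -/
theorem pathIn_image₂ (X : IntCrossData m N k₀ K T₁ T₁' T₂ T₂' R₀ χ₁ χ₂) {z₂ x y : Site 2} (h : PathIn triGraph (X.D₂.AsetB \ {z₂}) x y) :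
    PathIn triGraph (X.Aset𝔄 \ {X.φ₂ z₂}) (X.φ₂ x) (X.φ₂ y) := by
  refine (pathIn_map_iso X.φ₂ h).mono ?_
  rintro w ⟨v, ⟨hv, hvz⟩, rfl⟩
  exact ⟨Or.inr ⟨v, hv, rfl⟩, fun e => hvz (X.φ₂.injective (Set.mem_singleton_iff.1 e))⟩

/-- **An actual cut.** [folklore] -/
def IsCut𝔄 (z : Site 2) : Prop :=
  z ∈ X.Aset𝔄 ∧ ∀ s ∈ X.Src, ∀ t ∈ X.Tset𝔗, ¬ PathIn triGraph (X.Aset𝔄 \ {z}) s t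

/-- An actual cut through `φ₁` is a cut of `D₁` for the enlarged set. [folklore] -/
theorem isCutB₁_of_isCut𝔄 (X : IntCrossData m N k₀ K T₁ T₁' T₂ T₂' R₀ χ₁ χ₂) {z₁ : Site 2} (h : X.IsCut𝔄 (X.φ₁ z₁)) (hz : z₁ ∈ X.D₁.AsetB) : X.D₁.IsCutB z₁ := by
  refine ⟨hz, fun u c z hu hm => ?_, fun u d z hu hm => ?_⟩
  · obtain ⟨i, hp⟩ := hm
    exact h.2 _ (X.start_mem₁ i) _ (Or.inl ⟨_, Or.inl ⟨u, c, z, hu, rfl⟩, rfl⟩) (X.pathIn_image₁ hp)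
  · obtain ⟨i, hp⟩ := hm
    exact h.2 _ (X.start_mem₁ i) _ (Or.inl ⟨_, Or.inr ⟨u, d, z, hu, rfl⟩, rfl⟩) (X.pathIn_image₁ hp)

/-- An actual cut through `φ₂` is a cut of `D₂` for the enlarged set. [folklore] -/
theorem isCutB₂_of_isCut𝔄 (X : IntCrossData m N k₀ K T₁ T₁' T₂ T₂' R₀ χ₁ χ₂) {z₂ : Site 2} (h : X.IsCut𝔄 (X.φ₂ z₂)) (hz : z₂ ∈ X.D₂.AsetB) : X.D₂.IsCutB z₂ := by
  refine ⟨hz, fun u c z hu hm => ?_, fun u d z hu hm => ?_⟩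
  · obtain ⟨i, hp⟩ := hm
    exact h.2 _ (X.start_mem₂ i) _ (Or.inr ⟨_, Or.inl ⟨u, c, z, hu, rfl⟩, rfl⟩) (X.pathIn_image₂ hp)
  · obtain ⟨i, hp⟩ := hm
    exact h.2 _ (X.start_mem₂ i) _ (Or.inr ⟨_, Or.inr ⟨u, d, z, hu, rfl⟩, rfl⟩) (X.pathIn_image₂ hp)

/-- A route of `D₁` to a fence site gives an actual route. [folklore] -/
theorem not_isCut𝔄_of_route₁ (X : IntCrossData m N k₀ K T₁ T₁' T₂ T₂' R₀ χ₁ χ₂) {z₁ : Site 2} {i : Fin 2} {t : Site 2} (ht : t ∈ X.D₁.TsetB)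
    (hp : PathIn triGraph (X.D₁.AsetB \ {z₁}) (X.D₁.b i) t) : ¬ X.IsCut𝔄 (X.φ₁ z₁) := fun h =>
  h.2 _ (X.start_mem₁ i) _ (Or.inl ⟨t, ht, rfl⟩) (X.pathIn_image₁ hp)

/-- A route of `D₂` to a fence site gives an actual route. [folklore] -/
theorem not_isCut𝔄_of_route₂ (X : IntCrossData m N k₀ K T₁ T₁' T₂ T₂' R₀ χ₁ χ₂) {z₂ : Site 2} {i : Fin 2} {t : Site 2} (ht : t ∈ X.D₂.TsetB)
    (hp : PathIn triGraph (X.D₂.AsetB \ {z₂}) (X.D₂.b i) t) : ¬ X.IsCut𝔄 (X.φ₂ z₂) := fun h =>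
  h.2 _ (X.start_mem₂ i) _ (Or.inr ⟨t, ht, rfl⟩) (X.pathIn_image₂ hp)

/-! ### The blocking dichotomy for the arm `0` of one structure -/

/-- **If neither canonical route of the arm `0` exists off `zz ∉ (arms)`, and `zz` is off both fence
connections, the double block is reached — contradiction.** [cite: Nolin2008, §4.4 Lemma 15 (proof) (arXiv 0711.4948: Lemma 14)] -/
theorem IntPairDataB_route_or {m N k₀ K T T' R₀ : ℕ} {χ : SiteConfig (Site 2)} (D : IntPairDataB m N k₀ K T T' R₀ χ)
    {zz : Site 2} (hzarm : zz ∉ D.armSet) {c : Finset (Site 2)} {zc : Site 2}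
    (hu : (intDom m).lowestSeq χ D.uMin = some (c, zc)) {d : Finset (Site 2)} {zd : Site 2}
    (hu' : (intDom m).flip.lowestSeq χ D.uMinUp = some (d, zd))
    (hFc : zz ∉ (D.fence hu).F) (hFd : zz ∉ (D.fenceUp hu').F) :
    (∃ i, PathIn triGraph (D.AsetB \ {zz}) (D.b i) (D.fence hu).m') ∨
      (∃ i, PathIn triGraph (D.AsetB \ {zz}) (D.b i) (D.fenceUp hu').m') := by
  classical
  by_contra hno
  push Not at hno
  obtain ⟨hno_c, hno_d⟩ := hno
  have hc := IntPairData.term_isCrossing hu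
  have hd := IntPairDataB.termUp_isCrossing hu'
  -- not routable through `c`: the attachment is in `c` and separated from `α` by `zz`
  have hqc : (D.fence hu).q ∈ c ∧ ∀ x ∈ D.αF, x ∈ c → ¬ PathIn triGraph ((↑c : Set (Site 2)) \ {zz}) x (D.fence hu).q := by
    rcases (D.fence hu).q_mem with hq | hq
    · refine ⟨Finset.mem_coe.1 hq, fun x hx hxc hp => ?_⟩
      obtain ⟨i, hpi⟩ := D.route_c hu hzarm hFc (Or.inr ⟨x, hx, hxc, hp⟩)
      exact hno_c i hpi
    · obtain ⟨i, hpi⟩ := D.route_c hu hzarm hFc (Or.inl hq)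
      exact absurd hpi (hno_c i)
  have hqd : (D.fenceUp hu').q ∈ d ∧ ∀ x ∈ D.αF, x ∈ d → ¬ PathIn triGraph ((↑d : Set (Site 2)) \ {zz}) x (D.fenceUp hu').q := by
    rcases (D.fenceUp hu').q_mem with hq | hq
    · refine ⟨Finset.mem_coe.1 hq, fun x hx hxd hp => ?_⟩
      obtain ⟨i, hpi⟩ := D.route_d hu' hzarm hFd (Or.inr ⟨x, hx, hxd, hp⟩)
      exact hno_d i hpi
    · obtain ⟨i, hpi⟩ := D.route_d hu' hzarm hFd (Or.inl hq)
      exact absurd hpi (hno_d i)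
  -- `zz ∈ c`: otherwise `c ∖ {zz} = c` joins the contact of `α` to `q_c`
  have hzα : zz ∉ D.αF := fun h => hzarm (D.mem_armSet (D.αF_subset zz h))
  have hzc : zz ∈ c := by
    by_contra hzc
    obtain ⟨x, hx⟩ := D.αF_meet hu
    rw [Finset.mem_inter] at hx
    exact hqc.2 x hx.1 hx.2 ((hc.conn x hx.2 _ hqc.1).mono fun v hv => ⟨hv, fun e => hzc (by
      rw [Set.mem_singleton_iff] at e; rw [← e]; exact Finset.mem_coe.1 hv)⟩)
  have hzd : zz ∈ d := by
    by_contra hzd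
    obtain ⟨x, hx⟩ := D.αF_meetUp hu'
    rw [Finset.mem_inter] at hx
    exact hqd.2 x hx.1 hx.2 ((hd.conn x hx.2 _ hqd.1).mono fun v hv => ⟨hv, fun e => hzd (by
      rw [Set.mem_singleton_iff] at e; rw [← e]; exact Finset.mem_coe.1 hv)⟩)
  exact D.no_double_block hu hu' hzα hzc hzd hqc.1 hqd.1 hqc.2 hqd.2

/-! ### No actual cut -/

/-- **No actual admissible site is a cut.** [cite: Nolin2008, §4.4 Lemma 15 (proof) (arXiv 0711.4948: Lemma 14)] -/
theorem not_isCut𝔄 (X : IntCrossData m N k₀ K T₁ T₁' T₂ T₂' R₀ χ₁ χ₂) (z : Site 2) : ¬ X.IsCut𝔄 z := by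
  classical
  intro h
  have hz := h.1
  -- frame coordinates of `z`
  set z₁ := X.φ₁.symm z with hz₁
  set z₂ := X.φ₂.symm z with hz₂
  have ez₁ : X.φ₁ z₁ = z := X.φ₁.apply_symm_apply z
  have ez₂ : X.φ₂ z₂ = z := X.φ₂.apply_symm_apply z
  have h₁ : X.IsCut𝔄 (X.φ₁ z₁) := by rw [ez₁]; exact h
  have h₂ : X.IsCut𝔄 (X.φ₂ z₂) := by rw [ez₂]; exact h
  have corr : X.φ₂.symm (X.φ₁ z₁) = z₂ := by rw [ez₁]
  -- on an arm?
  by_cases harm : z₁ ∈ X.D₁.armSet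
  · obtain ⟨i, hi⟩ := harm
    fin_cases i
    · -- on the arm `0` of `D₁` = the arm `1` of `D₂`
      have hz2 : z₂ ∈ (X.D₂.A 1).support := by rw [← corr]; exact (X.arm0 z₁).1 hi
      exact X.D₂.not_isCutB_of_mem_arm1 hz2
        (X.isCutB₂_of_isCut𝔄 h₂ (X.D₂.Aset_subset_AsetB (X.D₂.armSet_subset_Aset (X.D₂.mem_armSet hz2))))
    · exact X.D₁.not_isCutB_of_mem_arm1 hi
        (X.isCutB₁_of_isCut𝔄 h₁ (X.D₁.Aset_subset_AsetB (X.D₁.armSet_subset_Aset (X.D₁.mem_armSet hi))))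
  -- off the arms, in both coordinate systems
  have harm₂ : z₂ ∉ X.D₂.armSet := fun h' => harm ((X.armSet_corr).2 (by rw [corr]; exact h'))
  obtain ⟨c₁, zc₁, hu₁, -⟩ := X.D₁.uMin_spec
  obtain ⟨d₁, zd₁, hu₁', -⟩ := X.D₁.uMinUp_spec
  obtain ⟨c₂, zc₂, hu₂, -⟩ := X.D₂.uMin_spec
  obtain ⟨d₂, zd₂, hu₂', -⟩ := X.D₂.uMinUp_spec
  -- routes in `D₁` unless `z₁` is on one of its two fences
  by_cases hF₁ : z₁ ∈ (X.D₁.fence hu₁).F ∨ z₁ ∈ (X.D₁.fenceUp hu₁').F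
  · -- then `z₂` is off the fences of `D₂`
    have hF₂ : z₂ ∉ (X.D₂.fence hu₂).F ∧ z₂ ∉ (X.D₂.fenceUp hu₂').F := by
      have key : ∀ (hy : (∃ (u : ℕ) (c : Finset (Site 2)) (z : Site 2) (hu : (intDom m).lowestSeq χ₂ u = some (c, z)),
            z₂ ∈ (X.D₂.fence hu).F) ∨
          (∃ (u : ℕ) (d : Finset (Site 2)) (z : Site 2) (hu : (intDom m).flip.lowestSeq χ₂ u = some (d, z)),
            z₂ ∈ (X.D₂.fenceUp hu).F)), False := fun hy =>
        X.fence_far z₁ z₂ (hF₁.elim (fun h' => Or.inl ⟨_, _, _, hu₁, h'⟩) (fun h' => Or.inr ⟨_, _, _, hu₁', h'⟩)) hy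
          (by rw [ez₁, ez₂])
      exact ⟨fun h' => key (Or.inl ⟨_, _, _, hu₂, h'⟩), fun h' => key (Or.inr ⟨_, _, _, hu₂', h'⟩)⟩
    rcases IntPairDataB_route_or X.D₂ harm₂ hu₂ hu₂' hF₂.1 hF₂.2 with ⟨i, hp⟩ | ⟨i, hp⟩
    · exact X.not_isCut𝔄_of_route₂ (Or.inl ⟨_, _, _, hu₂, rfl⟩) hp h₂
    · exact X.not_isCut𝔄_of_route₂ (Or.inr ⟨_, _, _, hu₂', rfl⟩) hp h₂
  · push Not at hF₁
    rcases IntPairDataB_route_or X.D₁ harm hu₁ hu₁' hF₁.1 hF₁.2 with ⟨i, hp⟩ | ⟨i, hp⟩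
    · exact X.not_isCut𝔄_of_route₁ (Or.inl ⟨_, _, _, hu₁, rfl⟩) hp h₁
    · exact X.not_isCut𝔄_of_route₁ (Or.inr ⟨_, _, _, hu₁', rfl⟩) hp h₁

/-! ### Menger -/

/-- **Menger's second hypothesis for the actual structure.** [cite: Nolin2008, §4.4 Lemma 15 (proof) (arXiv 0711.4948: Lemma 14)] -/
theorem menger_hcut𝔄 (X : IntCrossData m N k₀ K T₁ T₁' T₂ T₂' R₀ χ₁ χ₂) :
    ∀ z ∈ X.Aset𝔄, ∃ (s t : Site 2) (q : triGraph.Walk s t), s ∈ X.Src ∧ t ∈ X.Tset𝔗 ∧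
      (∀ y ∈ q.support, y ∈ X.Aset𝔄) ∧ z ∉ q.support := by
  intro z hz
  by_contra hno
  push Not at hno
  refine X.not_isCut𝔄 z ⟨hz, fun s hs t ht hp => ?_⟩
  obtain ⟨w, hw⟩ := hp.exists_walk
  exact (hw z (hno s t w hs ht fun y hy => (hw y hy).1)).2 rfl

/-- **Menger's first hypothesis for the actual structure.** [folklore] -/
theorem menger_hone𝔄 (X : IntCrossData m N k₀ K T₁ T₁' T₂ T₂' R₀ χ₁ χ₂) :
    ∃ (s t : Site 2) (q : triGraph.Walk s t), s ∈ X.Src ∧ t ∈ X.Tset𝔗 ∧ ∀ y ∈ q.support, y ∈ X.Aset𝔄 := by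
  obtain ⟨s, t, q, hs, ht, hA⟩ := X.D₁.hone
  have hp : PathIn triGraph X.D₁.Aset s t := (PathIn.of_walk_mem_support q (A := X.D₁.Aset) hA q.end_mem_support).1
  have hp' := pathIn_map_iso X.φ₁ hp
  obtain ⟨w, hw⟩ := hp'.exists_walk
  refine ⟨X.φ₁ s, X.φ₁ t, w, ?_, Or.inl ⟨t, Or.inl ht, rfl⟩, fun y hy => ?_⟩
  · simp only [Set.mem_insert_iff, Set.mem_singleton_iff] at hs
    rcases hs with rfl | rfl
    · exact X.start_mem₁ 0
    · exact X.start_mem₁ 1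
  · obtain ⟨v, hv, rfl⟩ := hw y hy
    exact Or.inl ⟨v, X.D₁.Aset_subset_AsetB hv, rfl⟩

/-- The two actual starts differ. [folklore] -/
theorem src_ne (X : IntCrossData m N k₀ K T₁ T₁' T₂ T₂' R₀ χ₁ χ₂) : X.φ₁ (X.D₁.b 0) ≠ X.φ₁ (X.D₁.b 1) := fun h => by
  have h' : X.D₁.b 0 = X.D₁.b 1 := X.φ₁.injective h
  exact X.D₁.disj _ (X.D₁.A 0).start_mem_support (by rw [h']; exact (X.D₁.A 1).start_mem_support)

/-- **The cross-frame pair step**: two vertex-disjoint actual admissible paths from the two starts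
to two distinct actual fence sites. [cite: Nolin2008, §4.4 Lemma 15 (proof) (arXiv 0711.4948: Lemma 14)] [cite: Diestel2017, Thm. 3.3.1] -/
theorem exists_two_disjoint_routes (X : IntCrossData m N k₀ K T₁ T₁' T₂ T₂' R₀ χ₁ χ₂) :
    ∃ (t₀ t₁ : Site 2) (p₀ : triGraph.Walk (X.φ₁ (X.D₁.b 0)) t₀) (p₁ : triGraph.Walk (X.φ₁ (X.D₁.b 1)) t₁),
      t₀ ∈ X.Tset𝔗 ∧ t₁ ∈ X.Tset𝔗 ∧ t₀ ≠ t₁ ∧ p₀.IsPath ∧ p₁.IsPath ∧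
      (∀ y ∈ p₀.support, y ∈ X.Aset𝔄) ∧ (∀ y ∈ p₁.support, y ∈ X.Aset𝔄) ∧ ∀ y ∈ p₀.support, y ∉ p₁.support := by
  classical
  obtain ⟨s₁, t₁, s₂, t₂, p₁, p₂, hs₁, ht₁, hs₂, ht₂, hp₁, hp₂, hA₁, hA₂, hdisj⟩ :=
    exists_two_disjoint_paths (G := triGraph) X.menger_hone𝔄 X.menger_hcut𝔄
  have hs : s₁ ≠ s₂ := fun h => hdisj s₁ p₁.start_mem_support (by rw [h]; exact p₂.start_mem_support)
  have ht : t₁ ≠ t₂ := fun h => hdisj _ p₁.end_mem_support (by rw [h]; exact p₂.end_mem_support)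
  simp only [Src, Set.mem_insert_iff, Set.mem_singleton_iff] at hs₁ hs₂
  rcases hs₁ with rfl | rfl <;> rcases hs₂ with rfl | rfl
  · exact absurd rfl hs
  · exact ⟨t₁, t₂, p₁, p₂, ht₁, ht₂, ht, hp₁, hp₂, hA₁, hA₂, hdisj⟩
  · exact ⟨t₂, t₁, p₂, p₁, ht₂, ht₁, ht.symm, hp₂, hp₁, hA₂, hA₁, fun y hy hy' => hdisj y hy' hy⟩
  · exact absurd rfl hs

end IntCrossData

end Literature.Probability.Percolation
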